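import Literature.Probability.LatticeModels.RotatedTorusLayers
import Literature.Probability.LatticeModels.DiagonalTransferMatrix
import Literature.Probability.LatticeModels.IsingCylinderState
import HarnessLib

/-!
# The diagonally wrapped torus `ℤ²/⟨(L,-L)…⟩`: layers, the diagonal transfer kernel, and the limit along the torus

Topic `Probability/LatticeModels`, namespace `Literature.Probability.LatticeModels`. Fifth file of
the exact computation of the critical diagonal correlations of the planar Ising model behind
`Literature.Probability.LatticeModels.wu_rhoCHI`. The transfer-matrix analysis of
`DiagonalTransferMatrix` … `DiagonalCylinderDeterminant` computes ground-state expectations of the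
two-layer diagonal transfer matrix `T₂ = KᵀK` on a ring of `N` registers; to identify them with
correlations of the Ising model one needs, as for rows (Benettin–Gallavotti–Jona-Lasinio–Stella,
Comm. Math. Phys. 30 (1973) 45, §3; the tree's `IsingTorusTransfer`, `OnsagerYang`), periodic
volumes whose Gibbs weight factorises along the transfer direction. For the diagonal direction these
are the **diagonally wrapped tori** `𝕋_{N,L} = ℤ²/Γ`, `Γ = ⟨(L, 0), (-N, N)⟩`, the quotient of `ℤ²`
by the kernel of

  `π : ℤ² → ℤ/Lℤ × ℤ/Nℤ`,  `π(x₀, x₁) = (x₀ + x₁, x₁)` :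

the first coordinate `a = x₀ + x₁` labels the ANTI-DIAGONAL layers,
the second `b = x₁` the position in a layer; each site of layer `a + 1` is joined to the sites `b`
and `b - 1` of layer `a`, so the coupling between consecutive layer configurations `R` (lower) and
`S` (upper) is `C(R, S) = ∑_b R(b)(S(b) + S(b+1))` for EVERY pair of consecutive layers (R. J. Baxter,
*Exactly solved models* (1982), §7.2; this is the two-parameter version of the rotated torus of the
tree's `RotatedTorus` / `RotatedTorusLayers`, Aizenman–Duminil-Copin 2021, proof of Prop. 5.4, which
has `L = 2N`). This file proves:

* Part 1 — the graph: `DiagSite N L = ℤ/Lℤ × ℤ/Nℤ`, the projection `diagProj` (an additive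
  homomorphism), the nearest-neighbour graph `diagGraph` (circulant, jumps `(1,0)`, `(1,1)`),
  injectivity of `π` on boxes of radius `R` with `2R < N`, `2N ≤ L`, and the correspondence of
  adjacency (`diagGraph_adj_proj_iff`) — the inputs of the Griffiths sandwich (next file);
* Part 2 — the energy along the anti-diagonal: for `3 ≤ N`, `2N ≤ L`,
  `-H(σ) = ∑_{a ∈ ℤ/Lℤ} C(σ_a, σ_{a+1})` (`neg_isingHamiltonian_diag_eq`), whence
  `∑_σ e^{-βH(σ)} f(σ₀) = Tr(diag f · 𝒦^L)` with the layer kernel `𝒦(R,S) = e^{βC(R,S)}`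
  (`sum_exp_mul_dlayerObs_eq_trace`) and the in-layer two-point function as a trace ratio
  (`diagTorusPair_eq_trace_div`);
* Part 3 — the bridge to the register picture: along `ℤ/Nℤ ≃ Fin N` the layer kernel is the
  TRANSPOSE of `diagKernel N β` (`layerKernel_eq_reindex`), `𝒦ᵀ = 𝒦 P` for the cyclic shift `P`
  (`C(S,R) = C(R, shift S)`), hence `𝒦^{2M} = (𝒦𝒦ᵀ)^M` whenever `N ∣ M` and `𝒦𝒦ᵀ ≅ T₂ = KᵀK`
  (`layerKernel_pow_two_mul`); consequently, for `L = 2NM'`,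
  `⟨σ_{(0,0)}σ_{(0,n)}⟩_{𝕋} = Tr(D_n T₂^{NM'})/Tr(T₂^{NM'})` and, by Perron
  (`tendsto_trace_mul_pow_div_of_perron` along the subsequence `NM'`),
  **`⟨σ_{(0,0)}σ_{(0,n)}⟩_{𝕋_{N,2NM'}} → ∑_r r_0 r_n ψ(r)² / ∑_r ψ(r)²`** as `M' → ∞` for any positive
  top eigenvector `ψ` of `T₂` (`tendsto_diagTorusPair`).

The marked sites `(0,0)`, `(0,n)` of layer `0` are the images of the lattice points `(0,0)` and
`(-n, n)`: an anti-diagonal pair. Everything is proved; no named fact.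

## References

* R. J. Baxter, *Exactly solved models in statistical mechanics* (1982), §7.2.
* G. Benettin, G. Gallavotti, G. Jona-Lasinio, A. L. Stella, Comm. Math. Phys. 30 (1973) 45–54, §3.
* M. Aizenman, H. Duminil-Copin, Ann. of Math. 194 (2021), proof of Prop. 5.4 (p. 18).
* T. D. Schultz, D. C. Mattis, E. H. Lieb, Rev. Mod. Phys. 36 (1964) 856, §II.
-/

noncomputable section

open MeasureTheory Filter Topology Finset Matrix Literature.LinearAlgebra.Matrix

namespace Literature.Probability.LatticeModels

/-! ### Part 1. The diagonally wrapped torus and its nearest-neighbour graph -/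

section Graph

/-- A site of the **diagonally wrapped torus** `ℤ²/⟨(L,0),(-N,N)⟩` in the coordinates
`(a, b) = (x₀ + x₁ mod L, x₁ mod N)`: the finite abelian group `ℤ/Lℤ × ℤ/Nℤ` (`a` = anti-diagonal
layer, `b` = position in the layer). [cite: BaxterExactlySolved1982, §7.2 (the square lattice drawn diagonally)] -/
abbrev DiagSite (N L : ℕ) : Type := ZMod L × ZMod N

/-- The projection `ℤ² → ℤ/Lℤ × ℤ/Nℤ`, `x ↦ (x₀ + x₁, x₁)`, an additive homomorphism with kernel
`⟨(L, 0), (-N, N)⟩`. [cite: BaxterExactlySolved1982, §7.2 (the square lattice drawn diagonally)] -/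
def diagProj (N L : ℕ) : Site 2 →+ DiagSite N L where
  toFun x := (((x 0 + x 1 : ℤ) : ZMod L), ((x 1 : ℤ) : ZMod N))
  map_zero' := by ext <;> simp
  map_add' x y := by
    ext
    · simp; ring_nf
    · simp

/-- First coordinate of the projection: `x₀ + x₁ mod L`. [folklore] -/
theorem diagProj_apply_fst (N L : ℕ) (x : Site 2) : (diagProj N L x).1 = ((x 0 + x 1 : ℤ) : ZMod L) := rfl

/-- Second coordinate of the projection: `x₁ mod N`. [folklore] -/
theorem diagProj_apply_snd (N L : ℕ) (x : Site 2) : (diagProj N L x).2 = ((x 1 : ℤ) : ZMod N) := rfl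

/-- The **nearest-neighbour graph of the diagonally wrapped torus**: the circulant graph on
`ℤ/Lℤ × ℤ/Nℤ` with jumps `π(e₀) = (1, 0)`, `π(e₁) = (1, 1)` (the quotient of the nearest-neighbour
graph of `ℤ²`). [cite: BaxterExactlySolved1982, §7.2 (the square lattice drawn diagonally)] -/
def diagGraph (N L : ℕ) : SimpleGraph (DiagSite N L) :=
  SimpleGraph.circulantGraph (Set.range fun i : Fin 2 => diagProj N L (Pi.single i 1))

/-- Adjacency on the diagonal torus, unfolded. [folklore] -/
theorem diagGraph_adj_iff {N L : ℕ} (u v : DiagSite N L) :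
    (diagGraph N L).Adj u v ↔
      u ≠ v ∧ ((∃ i, v = u + diagProj N L (Pi.single i 1)) ∨ ∃ i, u = v + diagProj N L (Pi.single i 1)) := by
  simp only [diagGraph, SimpleGraph.circulantGraph_adj, Set.mem_range]
  refine and_congr_right fun _ => ?_
  rw [or_comm]
  refine or_congr (exists_congr fun i => ?_) (exists_congr fun i => ?_)
  · rw [eq_sub_iff_add_eq', eq_comm]
  · rw [eq_sub_iff_add_eq', eq_comm]

/-- Adjacency on the diagonal torus is decidable. [folklore] -/
instance {N L : ℕ} : DecidableRel (diagGraph N L).Adj := fun u v =>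
  decidable_of_iff _ (diagGraph_adj_iff u v).symm

/-- Translations are automorphisms of the diagonal torus graph. [folklore] -/
theorem diagGraph_adj_add_right {N L : ℕ} (w u v : DiagSite N L) :
    (diagGraph N L).Adj (u + w) (v + w) ↔ (diagGraph N L).Adj u v := by
  simp only [diagGraph_adj_iff, add_right_comm _ w, add_left_inj, ne_eq]

/-- A lattice vector with both coordinates of absolute value `< N` projects to `0` only if it is `0`,
provided `2N ≤ L` (the nonzero elements of `⟨(L,0),(-N,N)⟩` have a coordinate of absolute value `≥ N`). [folklore] -/
theorem diagProj_eq_zero_iff_of_abs_lt {N L : ℕ} (hL : 2 * N ≤ L) {v : Site 2} (hv : ∀ j, |v j| < N) :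
    diagProj N L v = 0 ↔ v = 0 := by
  constructor
  · intro h
    have h1 : v 1 = 0 := by
      have hj : ((v 1 : ℤ) : ZMod N) = 0 := by
        have := congrArg Prod.snd h
        simpa [diagProj_apply_snd] using this
      rw [ZMod.intCast_zmod_eq_zero_iff_dvd] at hj
      exact Int.eq_zero_of_abs_lt_dvd hj (hv 1)
    have h0 : v 0 = 0 := by
      have hj : ((v 0 + v 1 : ℤ) : ZMod L) = 0 := by
        have := congrArg Prod.fst h
        simpa [diagProj_apply_fst] using this
      rw [h1, add_zero, ZMod.intCast_zmod_eq_zero_iff_dvd] at hj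
      refine Int.eq_zero_of_abs_lt_dvd hj ?_
      have := hv 0
      have hL' : (2 * N : ℤ) ≤ L := by exact_mod_cast hL
      linarith [abs_nonneg (v 0)]
    funext j
    fin_cases j
    · exact h0
    · exact h1
  · rintro rfl
    exact map_zero _

/-- `diagProj` is injective on a box of radius `R` with `2R < N`, `2N ≤ L`. [folklore] -/
theorem diagProj_injOn_box {N L R : ℕ} (hRN : 2 * R < N) (hL : 2 * N ≤ L) {x y : Site 2} (hx : x ∈ box 2 R)
    (hy : y ∈ box 2 R) (h : diagProj N L x = diagProj N L y) : x = y := by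
  have h0 : diagProj N L (x - y) = 0 := by rw [map_sub, h, sub_self]
  have := (diagProj_eq_zero_iff_of_abs_lt hL (v := x - y) fun j => ?_).1 h0
  · exact sub_eq_zero.1 this
  · rw [Pi.sub_apply]
    exact lt_of_le_of_lt (abs_sub_le_of_mem_box hx hy j) (by exact_mod_cast hRN)

/-- Adjacency of images of box points is adjacency in `ℤ²` (`2R + 1 < N`, `2N ≤ L`). [folklore] -/
theorem diagGraph_adj_proj_iff {N L R : ℕ} (hRN : 2 * R + 1 < N) (hL : 2 * N ≤ L) {x y : Site 2}
    (hx : x ∈ box 2 R) (hy : y ∈ box 2 R) :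
    (diagGraph N L).Adj (diagProj N L x) (diagProj N L y) ↔ (zdGraph 2).Adj x y := by
  have key : ∀ {x y : Site 2}, x ∈ box 2 R → y ∈ box 2 R → ∀ i : Fin 2,
      (diagProj N L y = diagProj N L x + diagProj N L (Pi.single i 1) ↔ y = x + Pi.single i 1) := by
    intro x y hx hy i
    have hbound : ∀ j, |(y - x - Pi.single i 1 : Site 2) j| < N := fun j => by
      have h1 := abs_sub_le_of_mem_box hy hx j
      have h2 : |(Pi.single i (1 : ℤ) : Site 2) j| ≤ 1 := by
        rcases eq_or_ne j i with rfl | hj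
        · simp
        · simp [Pi.single_eq_of_ne hj]
      calc |(y - x - Pi.single i 1 : Site 2) j| = |(y j - x j) - (Pi.single i (1 : ℤ) : Site 2) j| := by
            simp [Pi.sub_apply]
        _ ≤ |y j - x j| + |(Pi.single i (1 : ℤ) : Site 2) j| := abs_sub _ _
        _ < N := by
            have : (2 * R + 1 : ℤ) < N := by exact_mod_cast hRN
            linarith
    have hrew : diagProj N L y = diagProj N L x + diagProj N L (Pi.single i 1) ↔
        diagProj N L (y - x - Pi.single i 1) = 0 := by
      rw [map_sub, map_sub, sub_sub, sub_eq_zero]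
    rw [hrew, diagProj_eq_zero_iff_of_abs_lt hL hbound, sub_sub, sub_eq_zero]
  rw [diagGraph_adj_iff, zdGraph_adj_iff]
  constructor
  · rintro ⟨-, h | h⟩
    · obtain ⟨i, hi⟩ := h
      exact ⟨i, Or.inl ((key hx hy i).1 hi)⟩
    · obtain ⟨i, hi⟩ := h
      exact ⟨i, Or.inr ((key hy hx i).1 hi)⟩
  · rintro ⟨i, h | h⟩
    · refine ⟨fun hxy => ?_, Or.inl ⟨i, (key hx hy i).2 h⟩⟩
      have := diagProj_injOn_box (by omega) hL hx hy hxy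
      subst this
      simpa using congrFun h i
    · refine ⟨fun hxy => ?_, Or.inr ⟨i, (key hy hx i).2 h⟩⟩
      have := diagProj_injOn_box (by omega) hL hx hy hxy
      subst this
      simpa using congrFun h i

/-- The neighbours in the diagonal torus of the image of `x ∈ ℤ²` are the images of its lattice
neighbours (any `N, L`). [folklore] -/
theorem diagGraph_adj_proj_left_iff (N L : ℕ) (x : Site 2) (v : DiagSite N L) :
    (diagGraph N L).Adj (diagProj N L x) v ↔
      diagProj N L x ≠ v ∧ ∃ y, diagProj N L y = v ∧ (zdGraph 2).Adj x y := by
  rw [diagGraph_adj_iff]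
  refine and_congr_right fun hne => ?_
  constructor
  · rintro (⟨i, rfl⟩ | ⟨i, h⟩)
    · exact ⟨x + Pi.single i 1, by rw [map_add], (zdGraph_adj_iff _ _).2 ⟨i, Or.inl rfl⟩⟩
    · refine ⟨x - Pi.single i 1, ?_, (zdGraph_adj_iff _ _).2 ⟨i, Or.inr (by simp)⟩⟩
      rw [map_sub, h, add_sub_cancel_right]
  · rintro ⟨y, rfl, hxy⟩
    obtain ⟨i, h | h⟩ := (zdGraph_adj_iff _ _).1 hxy
    · exact Or.inl ⟨i, by rw [h, map_add]⟩
    · exact Or.inr ⟨i, by rw [h, map_add]⟩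

/-- The jumps: `π(e₀) = (1, 0)`. [folklore] -/
theorem diagProj_single_zero (N L : ℕ) : diagProj N L (Pi.single 0 1) = ((1 : ZMod L), (0 : ZMod N)) := by
  ext
  · rw [diagProj_apply_fst]; simp
  · rw [diagProj_apply_snd]; simp

/-- `π(e₁) = (1, 1)`. [folklore] -/
theorem diagProj_single_one (N L : ℕ) : diagProj N L (Pi.single 1 1) = ((1 : ZMod L), (1 : ZMod N)) := by
  ext
  · rw [diagProj_apply_fst]; simp
  · rw [diagProj_apply_snd]; simp

/-- For `3 ≤ N`, `2N ≤ L` no jump is the negative of a jump. [folklore] -/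
theorem diagProj_single_ne_neg {N L : ℕ} (hN : 3 ≤ N) (hL : 2 * N ≤ L) (i i' : Fin 2) :
    diagProj N L (Pi.single i 1) ≠ -diagProj N L (Pi.single i' 1) := by
  intro h
  have h2 : diagProj N L (Pi.single i 1 + Pi.single i' 1) = 0 := by rw [map_add, h, neg_add_cancel]
  have := (diagProj_eq_zero_iff_of_abs_lt hL (v := Pi.single i 1 + Pi.single i' 1) fun j => ?_).1 h2
  · have := congrFun this i
    simp only [Pi.add_apply, Pi.single_eq_same, Pi.zero_apply] at this
    rcases eq_or_ne i i' with rfl | hii'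
    · simp at this
    · rw [Pi.single_eq_of_ne hii'] at this; simp at this
  · rw [Pi.add_apply]
    have h1 : |(Pi.single i (1 : ℤ) : Site 2) j| ≤ 1 := by
      rcases eq_or_ne j i with rfl | hj
      · simp
      · simp [Pi.single_eq_of_ne hj]
    have h1' : |(Pi.single i' (1 : ℤ) : Site 2) j| ≤ 1 := by
      rcases eq_or_ne j i' with rfl | hj
      · simp
      · simp [Pi.single_eq_of_ne hj]
    have : (3 : ℤ) ≤ N := by exact_mod_cast hN
    calc |(Pi.single i (1 : ℤ) : Site 2) j + (Pi.single i' (1 : ℤ) : Site 2) j|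
        ≤ |(Pi.single i (1 : ℤ) : Site 2) j| + |(Pi.single i' (1 : ℤ) : Site 2) j| := abs_add_le _ _
      _ < N := by linarith

/-- The two jumps are distinct (`N ≥ 3`, `2N ≤ L`). [folklore] -/
theorem diagProj_single_injective {N L : ℕ} (hN : 3 ≤ N) (hL : 2 * N ≤ L) :
    Function.Injective fun i : Fin 2 => diagProj N L (Pi.single i 1) := by
  intro i i' h
  simp only at h
  have h2 : diagProj N L (Pi.single i 1 - Pi.single i' 1) = 0 := by rw [map_sub, h, sub_self]
  have := (diagProj_eq_zero_iff_of_abs_lt hL (v := Pi.single i 1 - Pi.single i' 1) fun j => ?_).1 h2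
  · by_contra hii'
    have := congrFun this i
    simp only [Pi.sub_apply, Pi.single_eq_same, Pi.zero_apply, Pi.single_eq_of_ne hii'] at this
    simp at this
  · rw [Pi.sub_apply]
    have h1 : |(Pi.single i (1 : ℤ) : Site 2) j| ≤ 1 := by
      rcases eq_or_ne j i with rfl | hj
      · simp
      · simp [Pi.single_eq_of_ne hj]
    have h1' : |(Pi.single i' (1 : ℤ) : Site 2) j| ≤ 1 := by
      rcases eq_or_ne j i' with rfl | hj
      · simp
      · simp [Pi.single_eq_of_ne hj]
    have : (3 : ℤ) ≤ N := by exact_mod_cast hN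
    calc |(Pi.single i (1 : ℤ) : Site 2) j - (Pi.single i' (1 : ℤ) : Site 2) j|
        ≤ |(Pi.single i (1 : ℤ) : Site 2) j| + |(Pi.single i' (1 : ℤ) : Site 2) j| := abs_sub _ _
      _ < N := by linarith

/-- **The edges of the diagonal torus, each counted once**: for `N ≥ 3`, `2N ≤ L`,
`∑_{e ∈ E} F(e) = ∑_u ∑_{i<2} F({u, u + π(eᵢ)})`. [folklore] -/
theorem sum_edgeFinset_diagGraph {N L : ℕ} [NeZero N] [NeZero L] (hN : 3 ≤ N) (hL : 2 * N ≤ L) {M : Type*}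
    [AddCommMonoid M] (F : Sym2 (DiagSite N L) → M) :
    ∑ e ∈ (diagGraph N L).edgeFinset, F e = ∑ u : DiagSite N L, ∑ i : Fin 2, F s(u, u + diagProj N L (Pi.single i 1)) := by
  classical
  set J : Fin 2 → DiagSite N L := fun i => diagProj N L (Pi.single i 1) with hJ
  have hJ0 : ∀ i, J i ≠ 0 := fun i h => by
    have := diagProj_single_ne_neg hN hL i i
    rw [show diagProj N L (Pi.single i 1) = J i from rfl, h, neg_zero] at this
    exact this rfl
  set φ : DiagSite N L × Fin 2 → Sym2 (DiagSite N L) := fun p => s(p.1, p.1 + J p.2) with hφ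
  have hinj : Set.InjOn φ (Finset.univ : Finset (DiagSite N L × Fin 2)) := by
    rintro ⟨u, i⟩ - ⟨v, i'⟩ - h
    simp only [hφ, Sym2.eq_iff] at h
    rcases h with ⟨rfl, h2⟩ | ⟨h1, h2⟩
    · exact Prod.ext rfl (diagProj_single_injective hN hL (add_left_cancel h2))
    · exfalso
      rw [h1, add_assoc, add_eq_left] at h2
      exact diagProj_single_ne_neg hN hL i' i (eq_neg_of_add_eq_zero_left h2)
  have hmaps : ∀ p ∈ (Finset.univ : Finset (DiagSite N L × Fin 2)), φ p ∈ (diagGraph N L).edgeFinset := by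
    rintro ⟨u, i⟩ -
    rw [SimpleGraph.mem_edgeFinset, hφ, SimpleGraph.mem_edgeSet, diagGraph_adj_iff]
    exact ⟨fun h => hJ0 i (by simpa using h.symm), Or.inl ⟨i, rfl⟩⟩
  have hsurj : ∀ e ∈ (diagGraph N L).edgeFinset, ∃ p ∈ (Finset.univ : Finset (DiagSite N L × Fin 2)), φ p = e := by
    intro e he
    induction e using Sym2.ind with
    | _ u v =>
      rw [SimpleGraph.mem_edgeFinset, SimpleGraph.mem_edgeSet, diagGraph_adj_iff] at he
      rcases he.2 with ⟨i, hi⟩ | ⟨i, hi⟩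
      · exact ⟨(u, i), Finset.mem_univ _, by rw [hφ, hi]⟩
      · refine ⟨(v, i), Finset.mem_univ _, ?_⟩
        show s(v, v + J i) = s(u, v)
        rw [show v + J i = u from hi.symm, Sym2.eq_swap]
  have himg : Finset.univ.image φ = (diagGraph N L).edgeFinset := by
    ext e
    simp only [Finset.mem_image, Finset.mem_univ, true_and]
    constructor
    · rintro ⟨p, rfl⟩; exact hmaps p (Finset.mem_univ _)
    · intro he
      obtain ⟨p, -, hp⟩ := hsurj e he
      exact ⟨p, hp⟩
  rw [← himg, Finset.sum_image hinj, Fintype.sum_prod_type]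

end Graph

/-! ### Part 2. Layers, the coupling between consecutive layers, and the trace formula -/

section Layers

variable {N L : ℕ}

/-- A configuration of one anti-diagonal layer: spins indexed by `ℤ/Nℤ`. [folklore] -/
abbrev DLayer (N : ℕ) : Type := ZMod N → ℤˣ

/-- The layer `a` of a torus configuration: `σ_a(b) = σ(a, b)`. [folklore] -/
def dlayerOf (σ : SpinConfig (DiagSite N L)) (a : ZMod L) : DLayer N := fun b => σ (a, b)

/-- Spins of a layer. [folklore] -/
theorem spinAt_dlayerOf (σ : SpinConfig (DiagSite N L)) (a : ZMod L) (b : ZMod N) :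
    spinAt b (dlayerOf σ a) = spinAt (a, b) σ := rfl

/-- Torus configurations as sequences of layers. [folklore] -/
def dlayersEquiv : SpinConfig (DiagSite N L) ≃ (ZMod L → DLayer N) where
  toFun := dlayerOf
  invFun R := fun u => R u.1 u.2
  left_inv _ := funext fun ⟨_, _⟩ => rfl
  right_inv _ := rfl

variable [NeZero N]

/-- The **coupling between consecutive anti-diagonal layers**: the lower layer `R` and the upper
layer `S`, each upper spin `S(b')` joined to `R(b')` and `R(b'-1)`:
`C(R, S) = ∑_b R(b) (S(b) + S(b+1))` (Baxter's `∑_j (K φ_{j+1}φ'_j + L φ_jφ'_j)` with `K = L`). [cite: BaxterExactlySolved1982, §7.2 (diagonal-to-diagonal transfer matrices V, W)] -/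
def layerCoupling (R S : DLayer N) : ℝ := ∑ b, spinAt b R * (spinAt b S + spinAt (b + 1) S)

variable (N) in
/-- The **layer transfer kernel** `𝒦(R, S) = e^{β C(R,S)}`. [cite: BaxterExactlySolved1982, §7.2 (diagonal-to-diagonal transfer matrices V, W)] -/
def layerKernel (β : ℝ) : Matrix (DLayer N) (DLayer N) ℝ := fun R S => Real.exp (β * layerCoupling R S)

/-- The layer kernel has positive entries. [folklore] -/
theorem layerKernel_pos (β : ℝ) (R S : DLayer N) : 0 < layerKernel N β R S := Real.exp_pos _

variable [NeZero L]

/-- **The energy of the diagonal torus along the anti-diagonal**: for `N ≥ 3`, `2N ≤ L`,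
`-H(σ) = ∑_a C(σ_a, σ_{a+1})`. [cite: BaxterExactlySolved1982, §7.2 (the partition function by diagonal transfer matrices)] -/
theorem neg_isingHamiltonian_diag_eq (hN : 3 ≤ N) (hL : 2 * N ≤ L) (σ : SpinConfig (DiagSite N L)) :
    -isingHamiltonian (diagGraph N L) Finset.univ 0 .free σ = ∑ a : ZMod L, layerCoupling (dlayerOf σ a) (dlayerOf σ (a + 1)) := by
  simp only [isingHamiltonian, interactionEdges_free, edgesIn_univ_eq, zero_mul, sub_zero, neg_neg,
    sum_edgeFinset_diagGraph hN hL, bondSpin_mk, Fin.sum_univ_two, diagProj_single_zero, diagProj_single_one,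
    Fintype.sum_prod_type, Prod.mk_add_mk, add_zero]
  refine Finset.sum_congr rfl fun a _ => ?_
  rw [layerCoupling]
  refine Finset.sum_congr rfl fun b _ => ?_
  simp only [spinAt_dlayerOf, mul_add]

/-- **`∑_σ e^{-βH(σ)} f(σ₀)` as a cyclic layer sum**: `= ∑_{R : ℤ/Lℤ → layers} f(R₀) ∏_a 𝒦(R_a, R_{a+1})`. [cite: SchultzMattisLieb1964, §II] -/
theorem sum_exp_mul_dlayerObs_eq (hN : 3 ≤ N) (hL : 2 * N ≤ L) (β : ℝ) (f : DLayer N → ℝ) :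
    ∑ σ : SpinConfig (DiagSite N L), Real.exp (-β * isingHamiltonian (diagGraph N L) Finset.univ 0 .free σ) * f (dlayerOf σ 0) =
      ∑ R : ZMod L → DLayer N, f (R 0) * ∏ a : ZMod L, layerKernel N β (R a) (R (a + 1)) := by
  rw [← Equiv.sum_comp dlayersEquiv.symm]
  refine Finset.sum_congr rfl fun R _ => ?_
  have hlay : ∀ a, dlayerOf (dlayersEquiv.symm R) a = R a := fun a => congrFun (dlayersEquiv.apply_symm_apply R) a
  rw [show -β * isingHamiltonian (diagGraph N L) Finset.univ 0 .free (dlayersEquiv.symm R) =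
      β * -isingHamiltonian (diagGraph N L) Finset.univ 0 .free (dlayersEquiv.symm R) by ring,
    neg_isingHamiltonian_diag_eq hN hL, Finset.mul_sum, Real.exp_sum, mul_comm]
  simp only [hlay, layerKernel]

/-- **Configuration sums with a layer-`0` observable are traces**: for `N ≥ 3`, `2N ≤ L`,
`∑_σ e^{-βH(σ)} f(σ₀) = Tr(diag f · 𝒦^L)`. [cite: SchultzMattisLieb1964, §II] -/
theorem sum_exp_mul_dlayerObs_eq_trace (hN : 3 ≤ N) (hL : 2 * N ≤ L) (β : ℝ) (f : DLayer N → ℝ) :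
    ∑ σ : SpinConfig (DiagSite N L), Real.exp (-β * isingHamiltonian (diagGraph N L) Finset.univ 0 .free σ) * f (dlayerOf σ 0) =
      (diagonal f * layerKernel N β ^ L).trace := by
  classical
  rw [sum_exp_mul_dlayerObs_eq hN hL β f]
  have key := sum_zmod_mul_mul_prod_cyclic_eq_trace (N := L) (layerKernel N β) f (fun _ => (1 : ℝ)) 0
  simp only [mul_one, ZMod.val_zero, pow_zero, Nat.sub_zero, diagonal_one] at key
  exact key

end Layers

/-! ### Part 3. The register picture: `𝒦 ≅ (diagKernel)ᵀ`, the shift, and powers -/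

section Registers

variable {N : ℕ} [NeZero N]

/-- A layer as a register row along `Fin N ≃ ℤ/Nℤ` (`ZMod.finEquiv`): `toRow R i = R(i)`. [folklore] -/
def toRow (R : DLayer N) : Row N := fun i => R (ZMod.finEquiv N i)

/-- A register row as a layer. [folklore] -/
def ofRow (r : Row N) : DLayer N := fun b => r ((ZMod.finEquiv N).symm b)

/-- `toRow ∘ ofRow = id`. [folklore] -/
@[simp] theorem toRow_ofRow (r : Row N) : toRow (ofRow r) = r := by
  funext i; simp [toRow, ofRow]

/-- `ofRow ∘ toRow = id`. [folklore] -/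
@[simp] theorem ofRow_toRow (R : DLayer N) : ofRow (toRow R) = R := by
  funext b; simp [toRow, ofRow]

/-- Layers and register rows are in bijection. [folklore] -/
def rowEquiv : DLayer N ≃ Row N := ⟨toRow, ofRow, ofRow_toRow, toRow_ofRow⟩

/-- The bijection is `toRow`. [folklore] -/
@[simp] theorem rowEquiv_apply (R : DLayer N) : rowEquiv R = toRow R := rfl

/-- Its inverse is `ofRow`. [folklore] -/
@[simp] theorem rowEquiv_symm_apply (r : Row N) : rowEquiv.symm r = ofRow r := rfl

/-- Spins along the bijection. [folklore] -/
theorem spinAt_toRow (R : DLayer N) (i : Fin N) : spinAt i (toRow R) = spinAt (ZMod.finEquiv N i) R := rfl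

/-- **The layer coupling is the diagonal-step energy of the register picture**:
`C(R, S) = diagEnergy (toRow S) (toRow R)` (each upper spin sees two lower spins). [cite: BaxterExactlySolved1982, §7.2 (diagonal-to-diagonal transfer matrices V, W)] -/
theorem layerCoupling_eq_diagEnergy (R S : DLayer N) : layerCoupling R S = diagEnergy (toRow S) (toRow R) := by
  rw [layerCoupling, diagEnergy, ← Equiv.sum_comp (ZMod.finEquiv N).toEquiv]
  refine Finset.sum_congr rfl fun i _ => ?_
  simp only [spinAt_toRow, RingEquiv.toEquiv_eq_coe, EquivLike.coe_coe, map_add, map_one]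

/-- **The layer kernel is the transposed register kernel**: `𝒦(R, S) = diagKernel (toRow S) (toRow R)`. [cite: BaxterExactlySolved1982, §7.2 (diagonal-to-diagonal transfer matrices V, W)] -/
theorem layerKernel_eq (β : ℝ) (R S : DLayer N) : layerKernel N β R S = diagKernel N β (toRow S) (toRow R) := by
  rw [layerKernel, diagKernel_apply, layerCoupling_eq_diagEnergy]

/-- **Cyclic layer sums are cyclic register sums with `(diagKernel)ᵀ`**. [folklore] -/
theorem sum_layers_eq_sum_rows {L : ℕ} [NeZero L] (β : ℝ) (f : DLayer N → ℝ) :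
    ∑ R : ZMod L → DLayer N, f (R 0) * ∏ a : ZMod L, layerKernel N β (R a) (R (a + 1)) =
      ∑ rs : ZMod L → Row N, f (ofRow (rs 0)) * ∏ a : ZMod L, (diagKernel N β)ᵀ (rs a) (rs (a + 1)) := by
  rw [← Equiv.sum_comp (Equiv.arrowCongr (Equiv.refl (ZMod L)) (rowEquiv (N := N))).symm]
  refine Finset.sum_congr rfl fun rs _ => ?_
  simp only [Equiv.arrowCongr_symm, Equiv.arrowCongr_apply, Equiv.refl_symm, Equiv.coe_refl, Function.comp_id,
    Function.comp_apply, transpose_apply, layerKernel_eq, rowEquiv_symm_apply, toRow_ofRow]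

/-- The cyclic shift of a register row, `(shift s)_i = s_{i-1}`. [folklore] -/
def Row.shiftR (s : Row N) : Row N := fun i => s (i - 1)

/-- The inverse shift, `(unshift r)_i = r_{i+1}`. [folklore] -/
def Row.unshiftR (r : Row N) : Row N := fun i => r (i + 1)

/-- `shift ∘ unshift = id`. [folklore] -/
@[simp] theorem Row.shiftR_unshiftR (r : Row N) : Row.shiftR (Row.unshiftR r) = r := by
  funext i; simp [Row.shiftR, Row.unshiftR]

/-- `unshift ∘ shift = id`. [folklore] -/
@[simp] theorem Row.unshiftR_shiftR (s : Row N) : Row.unshiftR (Row.shiftR s) = s := by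
  funext i; simp [Row.shiftR, Row.unshiftR]

/-- **Reading a diagonal step backwards is a shifted step**: `diagEnergy (shift s) r = diagEnergy r s`
(`∑_i r_i (s_{i-1} + s_i) = ∑_i s_i (r_i + r_{i+1})`). [folklore] -/
theorem diagEnergy_shiftR (r s : Row N) : diagEnergy (Row.shiftR s) r = diagEnergy r s := by
  simp only [diagEnergy, Row.shiftR, spinAt, add_sub_cancel_right, mul_add, Finset.sum_add_distrib]
  have h1 : ∑ i : Fin N, ((r i : ℤ) : ℝ) * ((s (i - 1) : ℤ) : ℝ) = ∑ i : Fin N, ((s i : ℤ) : ℝ) * ((r (i + 1) : ℤ) : ℝ) := by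
    rw [← Equiv.sum_comp (Equiv.addRight (1 : Fin N))]
    refine Finset.sum_congr rfl fun i _ => ?_
    simp only [Equiv.coe_addRight, add_sub_cancel_right]
    ring
  have h2 : ∑ i : Fin N, ((r i : ℤ) : ℝ) * ((s i : ℤ) : ℝ) = ∑ i : Fin N, ((s i : ℤ) : ℝ) * ((r i : ℤ) : ℝ) :=
    Finset.sum_congr rfl fun i _ => mul_comm _ _
  rw [h1, h2, add_comm]

/-- The coupling is invariant under the simultaneous shift of both rows. [folklore] -/
theorem diagEnergy_shiftR_shiftR (r s : Row N) : diagEnergy (Row.shiftR r) (Row.shiftR s) = diagEnergy r s := by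
  simp only [diagEnergy, Row.shiftR, spinAt, add_sub_cancel_right]
  rw [← Equiv.sum_comp (Equiv.addRight (1 : Fin N))]
  refine Finset.sum_congr rfl fun i _ => ?_
  simp only [Equiv.coe_addRight, add_sub_cancel_right]

variable (N) in
/-- The permutation matrix of the shift: `P(s', s) = [s' = shift s]`. [folklore] -/
def shiftMat : Matrix (Row N) (Row N) ℝ := fun s' s => if s' = Row.shiftR s then 1 else 0

/-- Right multiplication by the shift matrix: `(M P)(r, s) = M(r, shift s)`. [folklore] -/
theorem mul_shiftMat_apply (M : Matrix (Row N) (Row N) ℝ) (r s : Row N) : (M * shiftMat N) r s = M r (Row.shiftR s) := by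
  rw [Matrix.mul_apply, Finset.sum_eq_single (Row.shiftR s)]
  · simp [shiftMat]
  · intro b _ hb; simp [shiftMat, hb]
  · intro h; exact absurd (mem_univ _) h

/-- Left multiplication by the shift matrix: `(P M)(r, s) = M(unshift r, s)`. [folklore] -/
theorem shiftMat_mul_apply (M : Matrix (Row N) (Row N) ℝ) (r s : Row N) : (shiftMat N * M) r s = M (Row.unshiftR r) s := by
  rw [Matrix.mul_apply, Finset.sum_eq_single (Row.unshiftR r)]
  · simp [shiftMat]
  · intro b _ hb
    have : r ≠ Row.shiftR b := fun h => hb (by rw [h, Row.unshiftR_shiftR])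
    simp [shiftMat, this]
  · intro h; exact absurd (mem_univ _) h

/-- **`K = Kᵀ P`**: the register kernel is its transpose followed by the shift
(`diagKernel r s = diagKernel (shift s) r`). [folklore] -/
theorem diagKernel_eq_transpose_mul_shiftMat (β : ℝ) : diagKernel N β = (diagKernel N β)ᵀ * shiftMat N := by
  ext r s
  rw [mul_shiftMat_apply, transpose_apply, diagKernel_apply, diagKernel_apply, diagEnergy_shiftR]

/-- The shift commutes with the transposed kernel. [folklore] -/
theorem shiftMat_commute (β : ℝ) : Commute (shiftMat N) ((diagKernel N β)ᵀ) := by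
  change shiftMat N * (diagKernel N β)ᵀ = (diagKernel N β)ᵀ * shiftMat N
  ext r s
  rw [shiftMat_mul_apply, mul_shiftMat_apply, transpose_apply, transpose_apply, diagKernel_apply, diagKernel_apply,
    ← diagEnergy_shiftR_shiftR s (Row.unshiftR r), Row.shiftR_unshiftR]

/-- Powers of the shift matrix: `(Pᵏ)(s', s) = [s' = shiftᵏ s]`. [folklore] -/
theorem shiftMat_pow_apply (k : ℕ) (s' s : Row N) : (shiftMat N ^ k) s' s = if s' = (Row.shiftR^[k]) s then 1 else 0 := by
  induction k generalizing s' s with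
  | zero => simp [Matrix.one_apply]
  | succ k ih =>
    rw [pow_succ, mul_shiftMat_apply, ih, Function.iterate_succ_apply]

/-- `shiftᵏ s = (i ↦ s_{i-k})`. [folklore] -/
theorem shiftR_iterate (k : ℕ) (s : Row N) : (Row.shiftR^[k]) s = fun i => s (i - k • (1 : Fin N)) := by
  induction k generalizing s with
  | zero => funext i; simp
  | succ k ih =>
    rw [Function.iterate_succ_apply, ih]
    funext i
    simp only [Row.shiftR, succ_nsmul]
    congr 1
    abel

/-- **`P^N = 1`**: shifting `N` times is the identity on a ring of `N` registers. [folklore] -/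
theorem shiftMat_pow_N : shiftMat N ^ N = 1 := by
  ext s' s
  rw [shiftMat_pow_apply, shiftR_iterate, Matrix.one_apply]
  have hN : N • (1 : Fin N) = 0 := by simpa using (card_nsmul_eq_zero (x := (1 : Fin N)))
  simp only [hN, sub_zero]

/-- `P^M = 1` whenever `N ∣ M`. [folklore] -/
theorem shiftMat_pow_of_dvd {M : ℕ} (h : N ∣ M) : shiftMat N ^ M = 1 := by
  obtain ⟨k, rfl⟩ := h
  rw [pow_mul, shiftMat_pow_N, one_pow]

/-- **Two transfer steps and one shift make the symmetric two-layer matrix**: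
`(Kᵀ)^{2k} Pᵏ = T₂ᵏ` with `T₂ = KᵀK` (`K = KᵀP`, `P` commuting with `Kᵀ`). [folklore] -/
theorem transpose_pow_two_mul_mul_shiftMat_pow (β : ℝ) (k : ℕ) :
    (diagKernel N β)ᵀ ^ (2 * k) * shiftMat N ^ k = diagTwoLayer N β ^ k := by
  induction k with
  | zero => simp
  | succ k ih =>
    have hc : Commute (shiftMat N ^ k) ((diagKernel N β)ᵀ) := (shiftMat_commute β).pow_left k
    have hc2 := hc.mul_right hc
    have hT : diagTwoLayer N β = (diagKernel N β)ᵀ * ((diagKernel N β)ᵀ * shiftMat N) := by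
      rw [diagTwoLayer, ← diagKernel_eq_transpose_mul_shiftMat]
    rw [show 2 * (k + 1) = 2 * k + 2 by ring, pow_add, pow_two, pow_succ (shiftMat N) k,
      show (diagKernel N β)ᵀ ^ (2 * k) * ((diagKernel N β)ᵀ * (diagKernel N β)ᵀ) * (shiftMat N ^ k * shiftMat N) =
        (diagKernel N β)ᵀ ^ (2 * k) * ((diagKernel N β)ᵀ * (diagKernel N β)ᵀ * shiftMat N ^ k) * shiftMat N by
          simp only [mul_assoc],
      ← hc2.eq,
      show (diagKernel N β)ᵀ ^ (2 * k) * (shiftMat N ^ k * ((diagKernel N β)ᵀ * (diagKernel N β)ᵀ)) * shiftMat N =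
        ((diagKernel N β)ᵀ ^ (2 * k) * shiftMat N ^ k) * ((diagKernel N β)ᵀ * ((diagKernel N β)ᵀ * shiftMat N)) by
          simp only [mul_assoc],
      ih, ← hT, pow_succ]

/-- **`(Kᵀ)^{2M} = T₂^M` whenever `N ∣ M`.** [folklore] -/
theorem transpose_pow_two_mul_of_dvd (β : ℝ) {M : ℕ} (h : N ∣ M) :
    (diagKernel N β)ᵀ ^ (2 * M) = diagTwoLayer N β ^ M := by
  rw [← transpose_pow_two_mul_mul_shiftMat_pow β M, shiftMat_pow_of_dvd h, mul_one]

end Registers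

/-! ### Part 4. The in-layer two-point function of the diagonal torus and its limit along the torus -/

section Torus

/-- The **in-layer two-point function of the diagonally wrapped torus**,
`⟨σ_{(0,0)}σ_{(0,n)}⟩_{𝕋_{N,L};β}` (the whole finite vertex set as the volume, zero field; the two
marked sites of layer `0` are the images of the lattice points `(0,0)` and `(-n, n)`). Junk value `0`
for `N = 0` or `L = 0`. [cite: BenettinGallavottiJonaLasinioStella1973, eq. (3.3) (periodic two-point functions)] -/
def diagTorusPair (β : ℝ) (N L n : ℕ) : ℝ :=
  if h : 0 < N ∧ 0 < L then
    haveI : NeZero N := ⟨h.1.ne'⟩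
    haveI : NeZero L := ⟨h.2.ne'⟩
    isingTwoPoint (diagGraph N L) Finset.univ β 0 .free ((0 : ZMod L), (0 : ZMod N)) ((0 : ZMod L), ((n : ℕ) : ZMod N))
  else 0

variable {N : ℕ} [NeZero N]

/-- The layer pair observable `R ↦ R(0) R(n)`. [folklore] -/
def layerPairObs (N n : ℕ) [NeZero N] (R : DLayer N) : ℝ := spinAt (0 : ZMod N) R * spinAt ((n : ℕ) : ZMod N) R

/-- The index of `ℤ/Nℤ ≃ Fin N` carrying `n mod N`. [folklore] -/
theorem finEquiv_symm_natCast (n : ℕ) :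
    (ZMod.finEquiv N).symm ((n : ℕ) : ZMod N) = ⟨n % N, Nat.mod_lt n (Nat.pos_of_ne_zero (NeZero.ne N))⟩ := by
  obtain ⟨m, rfl⟩ : ∃ m, N = m + 1 := ⟨N - 1, by have := NeZero.ne N; omega⟩
  apply Fin.ext
  change ZMod.val ((n : ℕ) : ZMod (m + 1)) = n % (m + 1)
  exact ZMod.val_natCast (n := m + 1) n

/-- The index of `ℤ/Nℤ ≃ Fin N` carrying `0`. [folklore] -/
theorem finEquiv_symm_zero' : (ZMod.finEquiv N).symm (0 : ZMod N) = ⟨0, Nat.pos_of_ne_zero (NeZero.ne N)⟩ := by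
  have h := finEquiv_symm_natCast (N := N) 0
  simp only [Nat.cast_zero, Nat.zero_mod] at h
  exact h

/-- **The layer pair observable is the register pair observable** `rowPairObs` along `ofRow`. [folklore] -/
theorem layerPairObs_ofRow (n : ℕ) (r : Row N) :
    layerPairObs N n (ofRow r) = rowPairObs N n (Nat.pos_of_ne_zero (NeZero.ne N)) r := by
  rw [layerPairObs, rowPairObs, spinAt, spinAt, ofRow, ofRow, finEquiv_symm_zero', finEquiv_symm_natCast]
  rfl

/-- `∑_τ w(τ) g(layer 0 of glue τ)` over the whole torus as a plain configuration sum. [folklore] -/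
theorem sum_isingWeight_diag_mul {L : ℕ} [NeZero L] (β : ℝ) (g : DLayer N → ℝ) :
    ∑ τ : ↥(Finset.univ : Finset (DiagSite N L)) → ℤˣ,
        isingWeight (diagGraph N L) Finset.univ β 0 .free τ * g (dlayerOf (glue Finset.univ τ .free) 0) =
      ∑ σ : SpinConfig (DiagSite N L), Real.exp (-β * isingHamiltonian (diagGraph N L) Finset.univ 0 .free σ) * g (dlayerOf σ 0) := by
  classical
  rw [← Equiv.sum_comp (univCfgEquiv (DiagSite N L)).symm]
  refine Finset.sum_congr rfl fun σ _ => ?_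
  rw [isingWeight, glue_univ_eq, Equiv.apply_symm_apply]

/-- **The in-layer two-point function of the diagonal torus as a transfer-matrix trace ratio**: for
`N ≥ 3`, `2N ≤ L`, `⟨σ_{(0,0)}σ_{(0,n)}⟩_{𝕋} = Tr(D_n (Kᵀ)^L) / Tr((Kᵀ)^L)` with `K = diagKernel N β` and
`D_n = diag(r₀ r_n)`. [cite: SchultzMattisLieb1964, §II] -/
theorem diagTorusPair_eq_trace_div (β : ℝ) {L : ℕ} [NeZero L] (hN : 3 ≤ N) (hL : 2 * N ≤ L) (n : ℕ) :
    diagTorusPair β N L n =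
      (diagonal (rowPairObs N n (Nat.pos_of_ne_zero (NeZero.ne N))) * (diagKernel N β)ᵀ ^ L).trace /
        ((diagKernel N β)ᵀ ^ L).trace := by
  classical
  have hN0 : 0 < N := Nat.pos_of_ne_zero (NeZero.ne N)
  have hL0 : 0 < L := Nat.pos_of_ne_zero (NeZero.ne L)
  -- numerator and denominator as configuration sums
  have k1 := sum_isingWeight_diag_mul (N := N) (L := L) β (layerPairObs N n)
  have k2 := sum_isingWeight_diag_mul (N := N) (L := L) β fun _ => (1 : ℝ)
  rw [sum_exp_mul_dlayerObs_eq hN hL, sum_layers_eq_sum_rows] at k1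
  simp only [layerPairObs_ofRow] at k1
  have cyc1 := sum_zmod_mul_mul_prod_cyclic_eq_trace (N := L) ((diagKernel N β)ᵀ) (rowPairObs N n hN0) (fun _ => (1 : ℝ)) 0
  have cyc2 := sum_zmod_mul_mul_prod_cyclic_eq_trace (N := L) ((diagKernel N β)ᵀ) (fun _ => (1 : ℝ)) (fun _ => (1 : ℝ)) 0
  simp only [mul_one, one_mul, ZMod.val_zero, pow_zero, Nat.sub_zero, diagonal_one] at cyc1 cyc2
  rw [cyc1] at k1
  have e2 := sum_exp_mul_dlayerObs_eq hN hL β (fun _ : DLayer N => (1 : ℝ))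
  have r2 := sum_layers_eq_sum_rows (L := L) β (fun _ : DLayer N => (1 : ℝ))
  simp only [mul_one, one_mul] at k2 e2 r2
  rw [e2, r2, cyc2] at k2
  have key : (∑ τ : ↥(Finset.univ : Finset (DiagSite N L)) → ℤˣ,
      isingWeight (diagGraph N L) Finset.univ β 0 .free τ * layerPairObs N n (dlayerOf (glue Finset.univ τ .free) 0)) /
      (∑ τ : ↥(Finset.univ : Finset (DiagSite N L)) → ℤˣ, isingWeight (diagGraph N L) Finset.univ β 0 .free τ) =
      (diagonal (rowPairObs N n hN0) * (diagKernel N β)ᵀ ^ L).trace / ((diagKernel N β)ᵀ ^ L).trace := by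
    rw [k1, k2]
  rw [← key, diagTorusPair, dif_pos ⟨hN0, hL0⟩, isingTwoPoint, isingExpect,
    integral_isingMeasure _ _ _ _ _ (measurable_spinPair _ _), isingPartitionFunction]
  rfl

/-- **The in-layer two-point function through the two-layer transfer matrix**: for `N ≥ 3` and
`N ∣ M` (`M ≥ 1`), `⟨σ_{(0,0)}σ_{(0,n)}⟩_{𝕋_{N,2M}} = Tr(D_n T₂^M) / Tr(T₂^M)`. [cite: SchultzMattisLieb1964, §II] -/
theorem diagTorusPair_eq_trace_div_diagTwoLayer (β : ℝ) (hN : 3 ≤ N) {M : ℕ} (hM : 0 < M) (hNM : N ∣ M) (n : ℕ) :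
    diagTorusPair β N (2 * M) n =
      (diagonal (rowPairObs N n (Nat.pos_of_ne_zero (NeZero.ne N))) * diagTwoLayer N β ^ M).trace /
        (diagTwoLayer N β ^ M).trace := by
  haveI : NeZero (2 * M) := ⟨by omega⟩
  have hL : 2 * N ≤ 2 * M := Nat.mul_le_mul_left 2 (Nat.le_of_dvd hM hNM)
  rw [diagTorusPair_eq_trace_div β hN hL n, transpose_pow_two_mul_of_dvd β hNM]

/-- **The limit along the torus is the ground-state expectation** (Schultz–Mattis–Lieb 1964, §II,
"only the largest eigenvalue survives", made precise by Perron's theorem for the entrywise positive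
symmetric `T₂`): for `N ≥ 3`, any nonzero top eigenvector `ψ` of `T₂ = diagTwoLayer N β`, and every
`n`, `⟨σ_{(0,0)}σ_{(0,n)}⟩_{𝕋_{N, 2NM'}} → ∑_r r₀ r_n ψ(r)² / ∑_r ψ(r)²` as `M' → ∞`. [cite: SchultzMattisLieb1964, §II] -/
theorem tendsto_diagTorusPair {β : ℝ} (hN : 3 ≤ N) (n : ℕ) {Ω : Row N → ℝ} (hΩ0 : Ω ≠ 0)
    (hΩ : diagTwoLayer N β *ᵥ Ω = topEigenvalue (diagTwoLayer_isHermitian (N := N) β) • Ω) :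
    Tendsto (fun M' : ℕ => diagTorusPair β N (2 * (N * M')) n) atTop
      (𝓝 ((∑ r, rowPairObs N n (Nat.pos_of_ne_zero (NeZero.ne N)) r * Ω r ^ 2) / ∑ r, Ω r ^ 2)) := by
  classical
  have hN0 : 0 < N := Nat.pos_of_ne_zero (NeZero.ne N)
  have hlim := tendsto_trace_mul_pow_div_of_perron (diagTwoLayer_posSemidef (N := N) β)
    (diagTwoLayer_apply_pos β) (diagonal (rowPairObs N n hN0)) hΩ0
    (by convert hΩ using 2)
  have hval : (Ω ⬝ᵥ (diagonal (rowPairObs N n hN0) *ᵥ Ω)) / (Ω ⬝ᵥ Ω) =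
      (∑ r, rowPairObs N n hN0 r * Ω r ^ 2) / ∑ r, Ω r ^ 2 := by
    congr 1
    · rw [dotProduct]
      exact sum_congr rfl fun r _ => by rw [mulVec_diagonal]; ring
    · rw [dotProduct]
      exact sum_congr rfl fun r _ => by ring
  rw [← hval]
  -- along the subsequence `M = N M'`, `M' ≥ 1`
  have hsub : Tendsto (fun M' : ℕ => N * M') atTop atTop :=
    Filter.tendsto_atTop_mono (fun M' => Nat.le_mul_of_pos_left M' hN0) tendsto_id
  refine ((hlim.comp hsub).congr' ?_)
  filter_upwards [eventually_ge_atTop 1] with M' hM'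
  simp only [Function.comp]
  rw [diagTorusPair_eq_trace_div_diagTwoLayer β hN (Nat.mul_pos hN0 hM') (dvd_mul_right N M') n]

end Torus

end Literature.Probability.LatticeModels
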